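import Mathlib.Analysis.SpecialFunctions.Trigonometric.Inverse
import Mathlib.Tactic.LinearCombination
import HarnessLib

/-!
# Route GaussianScaleMixture — crux `RotationUpgradeFromTwoPoint` (stmt-CriticalPhenomena-8367),
# line `two-crystals-generate-so3`, stub `stub_arccosQuarter`

THEOREM-ONLY file (no definitions, no named facts). **`θ₀ := arccos(-1/4)` is not a rational
multiple of `2π`**: for all integers `m ≠ 0` and `k`, `m • θ₀ ≠ 2πk`. This is the infinite-order
input for the explicit element `N = R_z(30°) R_x(90°) R_z(30°)` (a rotation by `θ₀`) of the
invariance group in the line; it is consumed as a hypothesis by the neighbouring stub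
`stub_circleClosed`.

Proof (2-adic count, no Niven theorem). Put `bₙ := 2ⁿ · 2cos(nθ₀)`. Since `cos θ₀ = -1/4`
(`Real.cos_arccos`), the addition formula `cos(x + 2θ) = 2cos θ cos(x + θ) - cos x` gives the
integer recurrence `bₙ₊₂ = -bₙ₊₁ - 4bₙ` with `b₀ = 2`, `b₁ = -1`; hence `bₙ ∈ ℤ` for all `n` and
`bₙ` is odd for `n ≥ 1` (`acq_two_pow_mul_two_cos`). In particular `cos(nθ₀) ≠ 1` for `n ≥ 1`,
since otherwise `bₙ = 2ⁿ⁺¹` would be even (`acq_cos_nat_mul_ne_one`). Finally `mθ₀ = 2πk` with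
`m ≠ 0` forces `cos(|m|θ₀) = cos(mθ₀) = cos(2πk) = 1` with `|m| ≥ 1`, a contradiction.
-/

namespace Summit.CriticalPhenomena.Ising3DConformalLimit.Cruxes.RotationUpgradeFromTwoPoint.TwoCrystalsGenerateSo3

/-- The defining value `cos θ₀ = -1/4` of `θ₀ = arccos(-1/4)`. [folklore] -/
theorem acq_cos_arccos_quarter : Real.cos (Real.arccos (-1 / 4)) = -1 / 4 :=
  Real.cos_arccos (by norm_num) (by norm_num)

/-- The three-term (Chebyshev) recurrence for cosines of an arithmetic progression:
`cos(x + θ + θ) = 2cos θ · cos(x + θ) - cos x`. [folklore] -/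
theorem acq_cos_add_add (x θ : ℝ) :
    Real.cos (x + θ + θ) = 2 * Real.cos θ * Real.cos (x + θ) - Real.cos x := by
  have h := Real.cos_add (x + θ) θ
  have h' := Real.cos_sub (x + θ) θ
  rw [add_sub_cancel_right] at h'
  linear_combination h + h'

/-- Integrality and oddness of `bₙ := 2ⁿ · 2cos(nθ₀)`, `θ₀ = arccos(-1/4)`, proved for the pair
`(bₙ, bₙ₊₁)` simultaneously: `bₙ ∈ ℤ` and `bₙ₊₁` is an odd integer (recurrence
`bₙ₊₂ = -bₙ₊₁ - 4bₙ`, `b₀ = 2`, `b₁ = -1`). [folklore] -/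
theorem acq_two_pow_mul_two_cos (n : ℕ) :
    ∃ a b : ℤ, Odd b ∧
      (2 : ℝ) ^ n * (2 * Real.cos (n * Real.arccos (-1 / 4))) = a ∧
      (2 : ℝ) ^ (n + 1) * (2 * Real.cos ((n + 1 : ℕ) * Real.arccos (-1 / 4))) = b := by
  induction n with
  | zero =>
    refine ⟨2, -1, ⟨-1, by norm_num⟩, ?_, ?_⟩
    · simp
    · rw [Nat.cast_one, one_mul, acq_cos_arccos_quarter]
      norm_num
  | succ n ih =>
    obtain ⟨a, b, hb, ha, hb'⟩ := ih
    refine ⟨b, -b - 4 * a, ?_, hb', ?_⟩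
    · obtain ⟨j, rfl⟩ := hb
      exact ⟨-j - 1 - 2 * a, by ring⟩
    · have e1 : ((n + 1 : ℕ) : ℝ) * Real.arccos (-1 / 4)
          = (n : ℝ) * Real.arccos (-1 / 4) + Real.arccos (-1 / 4) := by
        push_cast; ring
      have e2 : ((n + 1 + 1 : ℕ) : ℝ) * Real.arccos (-1 / 4)
          = (n : ℝ) * Real.arccos (-1 / 4) + Real.arccos (-1 / 4) + Real.arccos (-1 / 4) := by
        push_cast; ring
      rw [e1] at hb'
      rw [e2, acq_cos_add_add, acq_cos_arccos_quarter]
      push_cast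
      linear_combination (-1 : ℝ) * hb' - 4 * ha

/-- For `n ≥ 1`, `cos(n θ₀) ≠ 1` where `θ₀ = arccos(-1/4)`: otherwise the odd integer
`bₙ = 2ⁿ · 2cos(nθ₀)` would equal the even integer `2ⁿ⁺¹`. [folklore] -/
theorem acq_cos_nat_mul_ne_one (n : ℕ) (hn : 1 ≤ n) :
    Real.cos (n * Real.arccos (-1 / 4)) ≠ 1 := by
  obtain ⟨j, rfl⟩ : ∃ j, n = j + 1 := ⟨n - 1, by omega⟩
  obtain ⟨_, b, hb, -, hb'⟩ := acq_two_pow_mul_two_cos j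
  intro h
  rw [h] at hb'
  have hbz : (2 : ℤ) ^ (j + 1) * (2 * 1) = b := by exact_mod_cast hb'
  have he : Even ((2 : ℤ) ^ (j + 1) * (2 * 1)) := ⟨2 ^ (j + 1), by ring⟩
  rw [hbz] at he
  exact Int.not_even_iff_odd.mpr hb he

/-- **Stub `stub_arccosQuarter`.** `θ₀ = arccos(-1/4)` is not a rational multiple of `2π`: for all
integers `m ≠ 0` and `k`, `m θ₀ ≠ 2πk` (equivalently, the rotation by `θ₀` has infinite order).
Proof: `mθ₀ = 2πk` gives `cos(|m| θ₀) = cos(m θ₀) = 1` with `|m| ≥ 1`, contradicting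
`acq_cos_nat_mul_ne_one`. [folklore] -/
theorem stub_arccosQuarter :
  ∀ m k : ℤ, m ≠ 0 → (m : ℝ) * Real.arccos (-1 / 4) ≠ (k : ℝ) * (2 * Real.pi) := by
  intro m k hm h
  have hcos : Real.cos ((m : ℝ) * Real.arccos (-1 / 4)) = 1 := by
    rw [h]
    exact Real.cos_int_mul_two_pi k
  obtain ⟨n, rfl | rfl⟩ := Int.eq_nat_or_neg m
  · rw [Int.cast_natCast] at hcos
    have hn : 1 ≤ n := Nat.one_le_iff_ne_zero.mpr fun h0 => hm (by rw [h0, Nat.cast_zero])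
    exact acq_cos_nat_mul_ne_one n hn hcos
  · rw [Int.cast_neg, Int.cast_natCast, neg_mul, Real.cos_neg] at hcos
    have hn : 1 ≤ n := Nat.one_le_iff_ne_zero.mpr fun h0 => hm (by rw [h0, Nat.cast_zero, neg_zero])
    exact acq_cos_nat_mul_ne_one n hn hcos

end Summit.CriticalPhenomena.Ising3DConformalLimit.Cruxes.RotationUpgradeFromTwoPoint.TwoCrystalsGenerateSo3
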